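import Literature.MathematicalPhysics.QuantumFieldTheory.Balaban1983to89.B9Eq315QLipschitzL2
import Literature.MathematicalPhysics.QuantumFieldTheory.Balaban1983to89.B9Eq315QTowerLipschitz

/-!
# `Balaban1983to89.B9Eq315QTowerLipschitzL2` — T. Bałaban, *Propagators for lattice gauge theories in a background field*, Commun. Math. Phys. **99**
# (1985) 389–434 [Balaban1985BackgroundPropagators] (3.15)–(3.16) p. 393, (3.35)–(3.37) p. 396, (3.78)–(3.79) p. 406, p. 407, with [Balaban1985Averaging]
# (124)–(127) pp. 36–37, Prop. 2 (52)–(54) p. 26: **THE TOWER AVERAGING LETTER `δ_{Q,k}` IN THE `L²` CURRENCY WITHOUT THE FINE VOLUME —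
# `‖Q_k(U)f − Q_k(1)f‖_{L²(c₁)} ≤ M_φ′M_φ·√(c₁∕(c₀L^{kd}))·(Π_{j<k}(1 + L^{d∕2}θ_j) − 1)·‖f‖_{L²(c₀)}`, `θ_j = √(2d)·102(d+1)²L·ε_j`** — the `ℓ²` telescoping of
# the one-step LOCAL letter (`B9Eq315QLipschitzL2`) with ne9-leaf-03's flat count (`B9Eq315QFlatNorm`): NO `|𝔅(T)|`, the number of levels entering ONLY
# through `Π_j(1 + L^{d∕2}θ_j) ≤ exp(L^{d∕2}Σ_j θ_j)`, bounded under the ε-profile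

statement-level skeleton of published theorems with citation tags; proofs where landed; nothing here is a claim about the Yang–Mills mass gap

PDF held: `paper:balaban1985-cmp99-background-propagators` (journal page = PDF page + 388) p. 393 (text layer p0005) and p. 396 (p0008) read by this seat (2026-08-22);
p. 406–407 and [Balaban1985Averaging] pp. 24, 36–37 through the verbatim quotations of the tree's `B9Eq315QTowerLipschitz`, `B9Eq315QFlatNorm`, `B9Eq315QLipschitzL2`.
THE PRINT (verbatim).  [B9] p. 393: *«Q_j(U) = Q(Ū^{j−1})…Q(U) (3.15)»*, *«⟨A, Q*aQA⟩ = Σ_{j=0}^{k} a Σ_{b∈Λ_j} (L^jη)^{d−2} |(Q_j(U)A)(b)|² (3.16)»*; p. 403: the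
averaging operators at `U` *«satisfy the same bounds»* as at `U = 1`; p. 407: *«semi-local operator … depends on A, A′ restricted to j-blocks neighbouring the
block containing the bond b.»*

WHY THIS FILE (cell context; OFFER O-ne9leaf02-g64-2 of the pub-balaban NE9 crux team, steps (ii)–(iii); ne9-leaf-04 W-10 «GO — NOT MINE, THIS SHAPE»).
The chain's `L²` letter `δ_{Q,k}` (`B9Eq315QTowerLipschitz.norm_QkW_sub_flat_le`, `B9Eq315QTowerLipschitzProfile` §3–§4) telescopes in SUP norms and
converts once at the end, paying `M_φ′M_φ·√(c₁|𝔅(T_m)|∕c₀)`; along print's weights (3.16) — `c₁(ηL^k)² = c₀L^{kd}`, as every consumer of the chain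
(`B9Eq326OperatorTowerFlatExplicit`, `B9Thm311SmallFieldCoercivityTowerScaled`) imposes — that factor is `√|𝔅(T_{L^k m})|∕(ηL^k)`, the FINE volume,
exponential in the number of levels.  THIS FILE telescopes in `ℓ²` instead: with the one-step local letter `θ_j = √(2d)·102(d+1)²L·ε_j` (its `√(2d)` the
overlap count) and the flat `ℓ²` contraction `L^{−d∕2}` per level, the normalised deviation `E_n := L^{nd∕2}·‖Q_n(U) − Q_n(1)‖_{ℓ²→ℓ²}` obeys
`1 + E_{n+1} ≤ (1 + E_n)(1 + L^{d∕2}θ_n)` — from `Q_{n+1}(U) − Q_{n+1}(1) = [Q_n(U) − Q_n(1)]∘Q(Ū^n) + Q_n(1)∘[Q(Ū^n) − Q(1)]` and `‖Q(Ū^n)‖ ≤ ‖Q(1)‖ + ‖Q(Ū^n)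
− Q(1)‖` (NO separate bound on `‖Q(V)‖`, hence NO α-letter beyond E162's admissibility) — so `E_k ≤ Π_{j<k}(1 + L^{d∕2}θ_j) − 1`, and the weighted reading
gives `√(c₁∕(c₀L^{kd})) = (ηL^k)⁻¹` exactly as for the flat letter (`B9Eq315QTowerFlatNorm`).

WHAT IS PROVED (sorry-free; proof lane — no `def`, no `Prop` placeholder, no inequality of the papers asserted hypothesis-free).
* §1 `sqrt_sum_norm_add_sq_le` ([folklore] Minkowski in `ℓ²` for normed-group-valued finite families, from Cauchy–Schwarz).
* §2 **`sqrt_sum_norm_sq_Qtower_flat_le`** — the flat composite is an `ℓ²`-CONTRACTION by `L^{−nd∕2}`: `√(Σ_c ‖(Q_n(1)A)(c)‖²) ≤ (L^{−d∕2})^n·√(Σ_b ‖A b‖²)`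
  (leaf-03's one-step count at every level torus).
* §3 **`sqrt_sum_norm_sq_Qtower_sub_flat_le`** — THE `ℓ²` TELESCOPING: `√(Σ_c ‖(Q_n(U)A)(c) − (Q_n(1)A)(c)‖²) ≤ (Π_{j<n}(1 + (L^{d∕2})·θ_j) − 1)·(L^{−d∕2})^n·√(Σ_b ‖A b‖²)`,
  `θ_j = √(2d)·102(d+1)²L·ε_j`, under the chain's per-depth displays (`hU1`, `hreg`, bond smallness `ε_j`) — volume-free, `k` only through the product.
* §4 **`norm_QkW_sub_flat_le_L2`** — THE READING ON THE CHAIN's CARRIERS: `‖Q_{n+1}(U)f − Q_{n+1}(1)f‖_{L²(c₁)} ≤ M_φ′M_φ·√(c₁∕(c₀(L^{n+1})^d))·(Π_{j≤n}(1 +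
  L^{d∕2}θ_j) − 1)·‖f‖_{L²(c₀)}` — the left-hand side VERBATIM that of `B9Eq315QTowerLipschitz.norm_QkW_sub_flat_le` (so it feeds `B9Thm311SmallFieldCoercivityTower`'s
  `hQ` and `…TowerScaled`'s `hQ` slot unchanged); **`norm_QkW_sub_flat_le_L2_exp`** (`Π ≤ exp`: `… ≤ M_φ′M_φ√(c₁∕(c₀L^{kd}))·(exp(L^{d∕2}√(2d)102(d+1)²L·Σ_{j<k}ε_j) − 1)·‖f‖`);
  **`norm_QkW_sub_flat_le_L2_geometric`** (under the restricted ε-profile `ε_j ≤ ε⋆r^j` for `j < k`: `Σ_{j<k} ε_j ≤ ε⋆∕(1−r)`, so the letter is FREE OF THE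
  NUMBER OF LEVELS and of every volume).
MODEL ∕ DECLARED READINGS.  (M1) those of `B9Eq315QTowerLipschitz(Profile)`: the per-depth displays of `B9Eq315QTower` (`hU1`, `hreg`, `α_j ≤ 1∕64`) and the
bond smallness `ε_j` of the level backgrounds are DISPLAYED (the α-profile is a theorem from (52) — `B9Eq315QTowerRegularityProfile` —, the ε-profile the
gauge question); (M2) the weighted reading's `√(c₁∕(c₀L^{kd}))` is `(ηL^k)⁻¹` along (3.16) (`B9Eq315QTowerFlatNorm.sqrt_ratio_canonical`), NOT a volume;
(M3) the constants `√(2d)`, `L^{d∕2}`, `102(d+1)²L` are explicit, «depending on d and L only», but cruder than print's (139)–(140) two-block-average bookkeeping.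
HONEST SCOPE.  [folklore] `ℓ²` telescoping of landed one-step counts; nothing of [B9] Lemma 3.1 ∕ (3.37); NOT summit progress (cell pub-balaban: NE9 NOT
PRINTED ∕ NOT PROVED, «NE9 ⇐ the named binders»; row WALLED ON A MODEL; spine PROVED 0∕9; rung (B)+1 finite T⁴ — NOT infinite volume, NOT mass gap, NOT Clay;
HONEST DEPENDENCY: continuum YM on T⁴ ⇐ BetaPertH ∧ nine spine estimates (0/9 proved); BetaPertH ⇐ (D1) ∧ (D4) ∧ CAP+tail; G-an2-4 gates asym, D1 and
NE2/3/4).  Filed by the NE9 crux-team leaf seat `b2b-balaban-t4-ne9-formalise-leaf-02` (gen 64); NEW file importing `B9Eq315QLipschitzL2` and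
`B9Eq315QTowerLipschitz`; nothing of the owner's ∕ leaf-03's ∕ leaf-04's files modified or restated.  Net new unproved facts: 0.
-/

noncomputable section

open scoped BigOperators

namespace Literature.MathematicalPhysics.QuantumFieldTheory.Balaban1983to89.B9Eq315QTowerLipschitzL2

open B4Sect5Torus (TSite)
open B9SectCLatticeCarrier (Bond)
open B7Prop1Explicit (U1 Wcx boxVec)
open B9Eq311L2Pairing (WL2)
open B11Eq103H1Complex (BondL2K)
open B9Eq319QprimeTorus (fineP)
open B9Eq315QTorus (perSite perCfg perCfg_apply cornerSite QtorusLin QtorusLin_apply)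
open B9Eq315QLipschitz (norm_apply_le_of_WL2)
open B9Eq315QFlatNorm (sum_norm_sq_QtorusLin_one_le)
open B9Eq315QLipschitzL2 (sum_norm_sq_QtorusLin_sub_flat_le)
open B9Eq315QTower (towerP UlevOf Qtower Qtower_succ QkOfU)
open B9Eq315QTowerFlat (UlevOf_one perCfg_UlevOf_one_mem_U1 norm_Wcx_UlevOf_one_sub_one_le)
open B9Eq315QTowerLipschitz (QtorusLin_apply_eq_of_eq)
open B9Eq326OperatorTower (QkW)

variable {d : ℕ} (L : ℕ) [NeZero L]

/-! ## §1 Minkowski in `ℓ²` for finite families -/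

omit [NeZero L] in
/-- `√(Σ ‖x_b + y_b‖²) ≤ √(Σ ‖x_b‖²) + √(Σ ‖y_b‖²)` (from Cauchy–Schwarz `Real.sum_mul_le_sqrt_mul_sqrt`). [folklore] -/
private theorem sqrt_sum_norm_add_sq_le {ι : Type*} [Fintype ι] {E : Type*} [SeminormedAddCommGroup E] (x y : ι → E) :
    Real.sqrt (∑ b, ‖x b + y b‖ ^ 2) ≤ Real.sqrt (∑ b, ‖x b‖ ^ 2) + Real.sqrt (∑ b, ‖y b‖ ^ 2) := by
  have hX : 0 ≤ Real.sqrt (∑ b, ‖x b‖ ^ 2) := Real.sqrt_nonneg _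
  have hY : 0 ≤ Real.sqrt (∑ b, ‖y b‖ ^ 2) := Real.sqrt_nonneg _
  have hcs : ∑ b, ‖x b‖ * ‖y b‖ ≤ Real.sqrt (∑ b, ‖x b‖ ^ 2) * Real.sqrt (∑ b, ‖y b‖ ^ 2) := Real.sum_mul_le_sqrt_mul_sqrt _ _ _
  rw [Real.sqrt_le_left (by positivity)]
  calc ∑ b, ‖x b + y b‖ ^ 2 ≤ ∑ b, (‖x b‖ + ‖y b‖) ^ 2 :=
        Finset.sum_le_sum fun b _ => pow_le_pow_left₀ (norm_nonneg _) (norm_add_le _ _) 2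
    _ = ∑ b, ‖x b‖ ^ 2 + 2 * ∑ b, ‖x b‖ * ‖y b‖ + ∑ b, ‖y b‖ ^ 2 := by
        rw [Finset.mul_sum, ← Finset.sum_add_distrib, ← Finset.sum_add_distrib]
        exact Finset.sum_congr rfl fun b _ => by ring
    _ ≤ ∑ b, ‖x b‖ ^ 2 + 2 * (Real.sqrt (∑ b, ‖x b‖ ^ 2) * Real.sqrt (∑ b, ‖y b‖ ^ 2)) + ∑ b, ‖y b‖ ^ 2 := by linarith
    _ = (Real.sqrt (∑ b, ‖x b‖ ^ 2) + Real.sqrt (∑ b, ‖y b‖ ^ 2)) ^ 2 := by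
        rw [add_sq, Real.sq_sqrt (by positivity), Real.sq_sqrt (by positivity)]; ring

omit [NeZero L] in
/-- `√(Σ ‖x_b − y_b‖²)`-form of the triangle inequality: `√Σ‖x‖² ≤ √Σ‖y‖² + √Σ‖x − y‖²`. [folklore] -/
private theorem sqrt_sum_norm_sq_le_add_sub {ι : Type*} [Fintype ι] {E : Type*} [SeminormedAddCommGroup E] (x y : ι → E) :
    Real.sqrt (∑ b, ‖x b‖ ^ 2) ≤ Real.sqrt (∑ b, ‖y b‖ ^ 2) + Real.sqrt (∑ b, ‖x b - y b‖ ^ 2) := by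
  have h := sqrt_sum_norm_add_sq_le y (fun b => x b - y b)
  simp only [add_sub_cancel] at h
  exact h

omit [NeZero L] in
/-- `(√a)^n = √(a^n)` for `a ≥ 0`. [folklore] -/
private theorem sqrt_pow_eq {a : ℝ} (ha : 0 ≤ a) : ∀ n : ℕ, (Real.sqrt a) ^ n = Real.sqrt (a ^ n)
  | 0 => by simp
  | n + 1 => by rw [pow_succ, sqrt_pow_eq ha n, pow_succ, Real.sqrt_mul (pow_nonneg ha n)]

/-! ## §2 The flat composite is an `ℓ²`-contraction by `L^{−nd∕2}` -/

section Tower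

variable {𝔸 : Type*} [NormedRing 𝔸] [NormedAlgebra ℂ 𝔸] [CompleteSpace 𝔸] [NormOneClass 𝔸]
  (m : Fin d → ℕ) [∀ i, NeZero (m i)] (hL : 1 ≤ L) (k : ℕ) (U : Bond d (towerP L m k) → 𝔸ˣ)
  (α : ℕ → ℝ) (hα1 : ∀ j, α j ≤ 1 / 64)
  (hU1 : ∀ (j : ℕ) (x : B7Prop1Explicit.Site d) (κ : Fin d), perCfg (towerP L m (j + 1)) (UlevOf L m k U j) x κ ∈ U1 𝔸)
  (hreg : ∀ (j : ℕ) (y : TSite d (towerP L m j)) (κ : Fin d) (r : Fin d → Fin L),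
    ‖((Wcx L (perCfg (towerP L m (j + 1)) (UlevOf L m k U j)) (cornerSite L y) κ (boxVec L r) : 𝔸ˣ) : 𝔸) - 1‖ ≤ α j)
  (εU : ℕ → ℝ) (hεU : ∀ j, 0 ≤ εU j) (hUε : ∀ (j : ℕ) (b : Bond d (towerP L m (j + 1))), ‖(UlevOf L m k U j b : 𝔸) - 1‖ ≤ εU j)

/-- **THE FLAT COMPOSITE IS AN `ℓ²`-CONTRACTION BY `L^{−nd∕2}`**: `√(Σ_c ‖(Q_n(1)A)(c)‖²) ≤ (L^{−d∕2})^n·√(Σ_b ‖A b‖²)` — ne9-leaf-03's one-step count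
`Σ_c ‖(Q(1)A)(c)‖² ≤ L^{−d}·Σ_b ‖A b‖²` at every level torus `towerP L m (j+1) → towerP L m j` (the flat factor's background `UlevOf L m k 1 j` IS `1`, `UlevOf_one`).
[cite: Balaban1985BackgroundPropagators, (3.15)–(3.16) p.393; Balaban1985Averaging, (125) p.36, p.39] -/
theorem sqrt_sum_norm_sq_Qtower_flat_le : ∀ (n : ℕ) (A : Bond d (towerP L m n) → 𝔸),
    Real.sqrt (∑ c : Bond d m, ‖Qtower L m hL (UlevOf L m k (fun _ : Bond d (towerP L m k) => (1 : 𝔸ˣ))) (fun _ => 0) (fun _ => by norm_num)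
        (perCfg_UlevOf_one_mem_U1 L m k) (norm_Wcx_UlevOf_one_sub_one_le L m k (fun _ => 0) (fun _ => le_rfl)) n A c‖ ^ 2) ≤
      (Real.sqrt (((L : ℝ) ^ d)⁻¹)) ^ n * Real.sqrt (∑ b : Bond d (towerP L m n), ‖A b‖ ^ 2)
  | 0, A => by
    rw [pow_zero, one_mul]
    exact le_of_eq (congrArg Real.sqrt (Finset.sum_congr rfl fun c _ => rfl))
  | n + 1, A => by
    -- the flat factor at level `n` IS the one-step flat averaging
    have hy1 : ∀ b, QtorusLin L (towerP L m n) hL (UlevOf L m k (fun _ : Bond d (towerP L m k) => (1 : 𝔸ˣ)) n) (by norm_num)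
        (perCfg_UlevOf_one_mem_U1 L m k n) (norm_Wcx_UlevOf_one_sub_one_le L m k (fun _ => 0) (fun _ => le_rfl) n) A b =
        QtorusLin L (towerP L m n) hL (fun _ : Bond d (fineP L (towerP L m n)) => (1 : 𝔸ˣ)) (show (0 : ℝ) ≤ 1 / 64 by norm_num)
        (B5Eq172FlatCoercivity.hU1_one L (towerP L m n)) (B5Eq172FlatCoercivity.hreg_one L (towerP L m n)) A b :=
      QtorusLin_apply_eq_of_eq L (towerP L m n) hL _ _ _ _ (UlevOf_one L m k n) _ _ _ A
    set y : Bond d (towerP L m n) → 𝔸 := QtorusLin L (towerP L m n) hL (UlevOf L m k (fun _ : Bond d (towerP L m k) => (1 : 𝔸ˣ)) n) (by norm_num)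
        (perCfg_UlevOf_one_mem_U1 L m k n) (norm_Wcx_UlevOf_one_sub_one_le L m k (fun _ => 0) (fun _ => le_rfl) n) A with hy
    have hcount : ∑ c, ‖y c‖ ^ 2 ≤ ((L : ℝ) ^ d)⁻¹ * ∑ b, ‖A b‖ ^ 2 := by
      have h := sum_norm_sq_QtorusLin_one_le L (towerP L m n) hL (show (0 : ℝ) ≤ 1 / 64 by norm_num)
        (B5Eq172FlatCoercivity.hU1_one L (towerP L m n)) (B5Eq172FlatCoercivity.hreg_one L (towerP L m n)) A
      refine le_of_eq_of_le ?_ h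
      exact Finset.sum_congr rfl fun c _ => by rw [hy1 c]
    have ih := sqrt_sum_norm_sq_Qtower_flat_le n y
    -- `Q_{n+1}(1) A = Q_n(1) (Q(1) A)` definitionally (`Qtower_succ` is `rfl`)
    have e : ∀ c, Qtower L m hL (UlevOf L m k (fun _ : Bond d (towerP L m k) => (1 : 𝔸ˣ))) (fun _ => 0) (fun _ => by norm_num)
        (perCfg_UlevOf_one_mem_U1 L m k) (norm_Wcx_UlevOf_one_sub_one_le L m k (fun _ => 0) (fun _ => le_rfl)) (n + 1) A c =
        Qtower L m hL (UlevOf L m k (fun _ : Bond d (towerP L m k) => (1 : 𝔸ˣ))) (fun _ => 0) (fun _ => by norm_num)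
        (perCfg_UlevOf_one_mem_U1 L m k) (norm_Wcx_UlevOf_one_sub_one_le L m k (fun _ => 0) (fun _ => le_rfl)) n y c := fun c => rfl
    simp only [e]
    refine ih.trans ?_
    rw [pow_succ, mul_assoc]
    refine mul_le_mul_of_nonneg_left ?_ (by positivity)
    calc Real.sqrt (∑ b, ‖y b‖ ^ 2) ≤ Real.sqrt (((L : ℝ) ^ d)⁻¹ * ∑ b, ‖A b‖ ^ 2) := Real.sqrt_le_sqrt hcount
      _ = Real.sqrt (((L : ℝ) ^ d)⁻¹) * Real.sqrt (∑ b, ‖A b‖ ^ 2) := Real.sqrt_mul (by positivity) _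

/-! ## §3 The `ℓ²` telescoping: `E_n ≤ Π_{j<n}(1 + L^{d∕2}θ_j) − 1` -/

include hεU hUε in
/-- **THE TOWER LETTER `δ_{Q,n}` IN `ℓ²`, VOLUME-FREE**: under the chain's per-depth displays,
`√(Σ_c ‖(Q_n(U)A)(c) − (Q_n(1)A)(c)‖²) ≤ (Π_{j<n}(1 + √(L^d)·θ_j) − 1)·(√(L^{−d}))^n·√(Σ_b ‖A b‖²)` with `θ_j = √(2d)·102(d+1)²L·ε_j` — the telescoping
`Q_{n+1}(U) − Q_{n+1}(1) = [Q_n(U) − Q_n(1)]∘Q(Ū^n) + Q_n(1)∘[Q(Ū^n) − Q(1)]` in `ℓ²` (Minkowski), the level-`n` factors bounded by §2 (flat) and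
`B9Eq315QLipschitzL2.sum_norm_sq_QtorusLin_sub_flat_le` (deviation), and `‖Q(Ū^n)x‖ ≤ ‖Q(1)x‖ + ‖(Q(Ū^n) − Q(1))x‖` — no bound on `‖Q(V)‖` is used.
[cite: Balaban1985BackgroundPropagators, (3.15) p.393, (3.35)–(3.37) p.396, (3.78)–(3.79) p.406, p.407; Balaban1985Averaging, (124)–(127) pp.36–37, Prop. 2 (52)–(54) p.26] -/
theorem sqrt_sum_norm_sq_Qtower_sub_flat_le : ∀ (n : ℕ) (A : Bond d (towerP L m n) → 𝔸),
    Real.sqrt (∑ c : Bond d m, ‖Qtower L m hL (UlevOf L m k U) α hα1 hU1 hreg n A c -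
        Qtower L m hL (UlevOf L m k (fun _ : Bond d (towerP L m k) => (1 : 𝔸ˣ))) (fun _ => 0) (fun _ => by norm_num)
          (perCfg_UlevOf_one_mem_U1 L m k) (norm_Wcx_UlevOf_one_sub_one_le L m k (fun _ => 0) (fun _ => le_rfl)) n A c‖ ^ 2) ≤
      ((∏ j ∈ Finset.range n, (1 + Real.sqrt ((L : ℝ) ^ d) * (Real.sqrt (2 * d) * (102 * (d + 1) ^ 2 * L * εU j)))) - 1) *
        ((Real.sqrt (((L : ℝ) ^ d)⁻¹)) ^ n * Real.sqrt (∑ b : Bond d (towerP L m n), ‖A b‖ ^ 2))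
  | 0, A => by simp
  | n + 1, A => by
    have hL0 : (0 : ℝ) < L := by exact_mod_cast hL
    -- shorthands for the level-`n` letters
    set θ : ℕ → ℝ := fun j => Real.sqrt (2 * d) * (102 * (d + 1) ^ 2 * L * εU j) with hθ
    have hθ0 : ∀ j, 0 ≤ θ j := fun j => by rw [hθ]; have := hεU j; positivity
    set ρ : ℝ := Real.sqrt (((L : ℝ) ^ d)⁻¹) with hρ
    have hρ0 : 0 ≤ ρ := Real.sqrt_nonneg _
    have hρL : Real.sqrt ((L : ℝ) ^ d) * ρ = 1 := by
      rw [hρ, ← Real.sqrt_mul (by positivity), mul_inv_cancel₀ (by positivity), Real.sqrt_one]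
    have hP1 : ∀ n', (1 : ℝ) ≤ ∏ j ∈ Finset.range n', (1 + Real.sqrt ((L : ℝ) ^ d) * θ j) := fun n' =>
      Finset.one_le_prod (s := Finset.range n') fun j _ => by have := hθ0 j; nlinarith [Real.sqrt_nonneg ((L : ℝ) ^ d)]
    set E : ℝ := (∏ j ∈ Finset.range n, (1 + Real.sqrt ((L : ℝ) ^ d) * θ j)) - 1 with hE
    have hE0 : 0 ≤ E := by rw [hE]; linarith [hP1 n]
    -- the two level-`n` images: `x` at the background, `y` at the flat one, and the flat factor identification
    set x : Bond d (towerP L m n) → 𝔸 := QtorusLin L (towerP L m n) hL (UlevOf L m k U n) (hα1 n) (hU1 n) (hreg n) A with hx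
    set y : Bond d (towerP L m n) → 𝔸 := QtorusLin L (towerP L m n) hL (UlevOf L m k (fun _ : Bond d (towerP L m k) => (1 : 𝔸ˣ)) n) (by norm_num)
        (perCfg_UlevOf_one_mem_U1 L m k n) (norm_Wcx_UlevOf_one_sub_one_le L m k (fun _ => 0) (fun _ => le_rfl) n) A with hy
    have hy1 : ∀ b, y b = QtorusLin L (towerP L m n) hL (fun _ : Bond d (fineP L (towerP L m n)) => (1 : 𝔸ˣ)) (show (0 : ℝ) ≤ 1 / 64 by norm_num)
        (B5Eq172FlatCoercivity.hU1_one L (towerP L m n)) (B5Eq172FlatCoercivity.hreg_one L (towerP L m n)) A b :=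
      QtorusLin_apply_eq_of_eq L (towerP L m n) hL _ _ _ _ (UlevOf_one L m k n) _ _ _ A
    -- the level-`n` counts: flat (leaf-03) and deviation (`B9Eq315QLipschitzL2`)
    have hflat : Real.sqrt (∑ b, ‖y b‖ ^ 2) ≤ ρ * Real.sqrt (∑ b, ‖A b‖ ^ 2) := by
      have h := sum_norm_sq_QtorusLin_one_le L (towerP L m n) hL (show (0 : ℝ) ≤ 1 / 64 by norm_num)
        (B5Eq172FlatCoercivity.hU1_one L (towerP L m n)) (B5Eq172FlatCoercivity.hreg_one L (towerP L m n)) A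
      have h' : ∑ b, ‖y b‖ ^ 2 ≤ ((L : ℝ) ^ d)⁻¹ * ∑ b, ‖A b‖ ^ 2 :=
        le_of_eq_of_le (Finset.sum_congr rfl fun c _ => by rw [hy1 c]) h
      calc Real.sqrt (∑ b, ‖y b‖ ^ 2) ≤ Real.sqrt (((L : ℝ) ^ d)⁻¹ * ∑ b, ‖A b‖ ^ 2) := Real.sqrt_le_sqrt h'
        _ = ρ * Real.sqrt (∑ b, ‖A b‖ ^ 2) := Real.sqrt_mul (by positivity) _
    have hdev : Real.sqrt (∑ b, ‖x b - y b‖ ^ 2) ≤ θ n * Real.sqrt (∑ b, ‖A b‖ ^ 2) := by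
      have h := sum_norm_sq_QtorusLin_sub_flat_le L (towerP L m n) hL (UlevOf L m k U n) (hα1 n) (hU1 n) (hreg n)
        (show (0 : ℝ) ≤ 1 / 64 by norm_num) (B5Eq172FlatCoercivity.hU1_one L (towerP L m n)) (B5Eq172FlatCoercivity.hreg_one L (towerP L m n))
        (hεU n) (fun b => hUε n b) A
      have h' : ∑ b, ‖x b - y b‖ ^ 2 ≤ 2 * d * (102 * (d + 1) ^ 2 * L * εU n) ^ 2 * ∑ b, ‖A b‖ ^ 2 :=
        le_of_eq_of_le (Finset.sum_congr rfl fun c _ => by rw [hy1 c]) h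
      calc Real.sqrt (∑ b, ‖x b - y b‖ ^ 2) ≤ Real.sqrt (2 * d * (102 * (d + 1) ^ 2 * L * εU n) ^ 2 * ∑ b, ‖A b‖ ^ 2) := Real.sqrt_le_sqrt h'
        _ = Real.sqrt ((θ n) ^ 2 * ∑ b, ‖A b‖ ^ 2) := by
            congr 1; rw [hθ]; simp only [mul_pow, Real.sq_sqrt (by positivity : (0 : ℝ) ≤ 2 * d)]
        _ = θ n * Real.sqrt (∑ b, ‖A b‖ ^ 2) := by rw [Real.sqrt_mul' _ (by positivity), Real.sqrt_sq (hθ0 n)]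
    -- the induction hypothesis at `x`, and the flat composite at `x − y`
    have ih := sqrt_sum_norm_sq_Qtower_sub_flat_le n x
    have hfl := sqrt_sum_norm_sq_Qtower_flat_le L m hL k n (x - y)
    -- Minkowski on the split `ΔQ_{n+1}A = ΔQ_n x + Q_n(1)(x − y)`
    have hsplit : ∀ c, Qtower L m hL (UlevOf L m k U) α hα1 hU1 hreg (n + 1) A c -
        Qtower L m hL (UlevOf L m k (fun _ : Bond d (towerP L m k) => (1 : 𝔸ˣ))) (fun _ => 0) (fun _ => by norm_num)
          (perCfg_UlevOf_one_mem_U1 L m k) (norm_Wcx_UlevOf_one_sub_one_le L m k (fun _ => 0) (fun _ => le_rfl)) (n + 1) A c =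
        (Qtower L m hL (UlevOf L m k U) α hα1 hU1 hreg n x c -
          Qtower L m hL (UlevOf L m k (fun _ : Bond d (towerP L m k) => (1 : 𝔸ˣ))) (fun _ => 0) (fun _ => by norm_num)
            (perCfg_UlevOf_one_mem_U1 L m k) (norm_Wcx_UlevOf_one_sub_one_le L m k (fun _ => 0) (fun _ => le_rfl)) n x c) +
        Qtower L m hL (UlevOf L m k (fun _ : Bond d (towerP L m k) => (1 : 𝔸ˣ))) (fun _ => 0) (fun _ => by norm_num)
          (perCfg_UlevOf_one_mem_U1 L m k) (norm_Wcx_UlevOf_one_sub_one_le L m k (fun _ => 0) (fun _ => le_rfl)) n (x - y) c := by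
      intro c
      have e1 : Qtower L m hL (UlevOf L m k U) α hα1 hU1 hreg (n + 1) A c = Qtower L m hL (UlevOf L m k U) α hα1 hU1 hreg n x c := rfl
      have e2 : Qtower L m hL (UlevOf L m k (fun _ : Bond d (towerP L m k) => (1 : 𝔸ˣ))) (fun _ => 0) (fun _ => by norm_num)
          (perCfg_UlevOf_one_mem_U1 L m k) (norm_Wcx_UlevOf_one_sub_one_le L m k (fun _ => 0) (fun _ => le_rfl)) (n + 1) A c =
          Qtower L m hL (UlevOf L m k (fun _ : Bond d (towerP L m k) => (1 : 𝔸ˣ))) (fun _ => 0) (fun _ => by norm_num)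
          (perCfg_UlevOf_one_mem_U1 L m k) (norm_Wcx_UlevOf_one_sub_one_le L m k (fun _ => 0) (fun _ => le_rfl)) n y c := rfl
      rw [e1, e2, map_sub, Pi.sub_apply]
      abel
    have hxy : Real.sqrt (∑ b, ‖x b‖ ^ 2) ≤ (ρ + θ n) * Real.sqrt (∑ b, ‖A b‖ ^ 2) := by
      have h := sqrt_sum_norm_sq_le_add_sub x y
      nlinarith [hflat, hdev]
    have hS0 : 0 ≤ Real.sqrt (∑ b : Bond d (towerP L m (n + 1)), ‖A b‖ ^ 2) := Real.sqrt_nonneg _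
    calc Real.sqrt (∑ c : Bond d m, ‖Qtower L m hL (UlevOf L m k U) α hα1 hU1 hreg (n + 1) A c -
            Qtower L m hL (UlevOf L m k (fun _ : Bond d (towerP L m k) => (1 : 𝔸ˣ))) (fun _ => 0) (fun _ => by norm_num)
              (perCfg_UlevOf_one_mem_U1 L m k) (norm_Wcx_UlevOf_one_sub_one_le L m k (fun _ => 0) (fun _ => le_rfl)) (n + 1) A c‖ ^ 2)
        = Real.sqrt (∑ c : Bond d m, ‖(Qtower L m hL (UlevOf L m k U) α hα1 hU1 hreg n x c -
            Qtower L m hL (UlevOf L m k (fun _ : Bond d (towerP L m k) => (1 : 𝔸ˣ))) (fun _ => 0) (fun _ => by norm_num)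
              (perCfg_UlevOf_one_mem_U1 L m k) (norm_Wcx_UlevOf_one_sub_one_le L m k (fun _ => 0) (fun _ => le_rfl)) n x c) +
            Qtower L m hL (UlevOf L m k (fun _ : Bond d (towerP L m k) => (1 : 𝔸ˣ))) (fun _ => 0) (fun _ => by norm_num)
              (perCfg_UlevOf_one_mem_U1 L m k) (norm_Wcx_UlevOf_one_sub_one_le L m k (fun _ => 0) (fun _ => le_rfl)) n (x - y) c‖ ^ 2) := by
          congr 1; exact Finset.sum_congr rfl fun c _ => by rw [hsplit c]
      _ ≤ Real.sqrt (∑ c : Bond d m, ‖Qtower L m hL (UlevOf L m k U) α hα1 hU1 hreg n x c -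
            Qtower L m hL (UlevOf L m k (fun _ : Bond d (towerP L m k) => (1 : 𝔸ˣ))) (fun _ => 0) (fun _ => by norm_num)
              (perCfg_UlevOf_one_mem_U1 L m k) (norm_Wcx_UlevOf_one_sub_one_le L m k (fun _ => 0) (fun _ => le_rfl)) n x c‖ ^ 2) +
          Real.sqrt (∑ c : Bond d m, ‖Qtower L m hL (UlevOf L m k (fun _ : Bond d (towerP L m k) => (1 : 𝔸ˣ))) (fun _ => 0) (fun _ => by norm_num)
              (perCfg_UlevOf_one_mem_U1 L m k) (norm_Wcx_UlevOf_one_sub_one_le L m k (fun _ => 0) (fun _ => le_rfl)) n (x - y) c‖ ^ 2) :=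
          sqrt_sum_norm_add_sq_le _ _
      _ ≤ E * (ρ ^ n * Real.sqrt (∑ b, ‖x b‖ ^ 2)) + ρ ^ n * Real.sqrt (∑ b, ‖x b - y b‖ ^ 2) :=
          add_le_add ih (hfl.trans (le_of_eq (by rw [hρ]; simp only [Pi.sub_apply])))
      _ ≤ E * (ρ ^ n * ((ρ + θ n) * Real.sqrt (∑ b, ‖A b‖ ^ 2))) + ρ ^ n * (θ n * Real.sqrt (∑ b, ‖A b‖ ^ 2)) := by
          gcongr
      _ = ((E * (1 + Real.sqrt ((L : ℝ) ^ d) * θ n) + Real.sqrt ((L : ℝ) ^ d) * θ n) * ρ) * (ρ ^ n * Real.sqrt (∑ b, ‖A b‖ ^ 2)) := by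
          linear_combination (-((E + 1) * θ n * ρ ^ n * Real.sqrt (∑ b, ‖A b‖ ^ 2))) * hρL
      _ = ((∏ j ∈ Finset.range (n + 1), (1 + Real.sqrt ((L : ℝ) ^ d) * θ j)) - 1) * (ρ ^ (n + 1) * Real.sqrt (∑ b, ‖A b‖ ^ 2)) := by
          rw [Finset.prod_range_succ, hE, pow_succ]; ring

end Tower

/-! ## §4 The reading on the chain's carriers: `QkW φ U` against `QkW φ 1`, volume-free -/

section Readings

/-- `Π_{j<n}(1 + t_j) ≤ exp(Σ_{j<n} t_j)` for `t_j ≥ 0`. [folklore] -/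
private theorem prod_one_add_le_exp_sum (t : ℕ → ℝ) (ht : ∀ j, 0 ≤ t j) (n : ℕ) :
    ∏ j ∈ Finset.range n, (1 + t j) ≤ Real.exp (∑ j ∈ Finset.range n, t j) := by
  rw [Real.exp_sum]
  exact Finset.prod_le_prod (fun j _ => by linarith [ht j]) fun j _ => by linarith [Real.add_one_le_exp (t j)]

/-- `Σ_{j<n} s·r^j ≤ s∕(1−r)` for `0 ≤ r < 1`, `0 ≤ s`. [folklore] -/
private theorem sum_geometric_le (s r : ℝ) (hs : 0 ≤ s) (hr0 : 0 ≤ r) (hr1 : r < 1) (n : ℕ) :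
    ∑ j ∈ Finset.range n, s * r ^ j ≤ s / (1 - r) := by
  rw [← Finset.mul_sum, div_eq_mul_one_div]
  refine mul_le_mul_of_nonneg_left ?_ hs
  have h := geom_sum_Ico_le_of_lt_one (m := 0) (n := n) hr0 hr1
  rw [pow_zero] at h
  rwa [Finset.range_eq_Ico]

variable {𝔸 : Type*} [NormedRing 𝔸] [NormedAlgebra ℂ 𝔸] [CompleteSpace 𝔸] [NormOneClass 𝔸]
  (m : Fin d → ℕ) [∀ i, NeZero (m i)] (n : ℕ) (hL : 1 ≤ L)
  {W : Type*} [NormedAddCommGroup W] [InnerProductSpace ℂ W] (φ : W ≃ₗ[ℂ] 𝔸) {Mφ Mφ' : ℝ} (hMφ : 0 ≤ Mφ) (hMφ' : 0 ≤ Mφ')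
  (hφ : ∀ w, ‖φ w‖ ≤ Mφ * ‖w‖) (hφ' : ∀ X, ‖φ.symm X‖ ≤ Mφ' * ‖X‖) {c₀ c₁ : ℝ} [Fact (0 < c₀)] [Fact (0 < c₁)]
  (U : Bond d (towerP L m (n + 1)) → 𝔸ˣ) (α : ℕ → ℝ) (hα1 : ∀ j, α j ≤ 1 / 64)
  (hU1 : ∀ (j : ℕ) (x : B7Prop1Explicit.Site d) (κ : Fin d), perCfg (towerP L m (j + 1)) (UlevOf L m (n + 1) U j) x κ ∈ U1 𝔸)
  (hreg : ∀ (j : ℕ) (y : TSite d (towerP L m j)) (κ : Fin d) (r : Fin d → Fin L),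
    ‖((Wcx L (perCfg (towerP L m (j + 1)) (UlevOf L m (n + 1) U j)) (cornerSite L y) κ (boxVec L r) : 𝔸ˣ) : 𝔸) - 1‖ ≤ α j)
  (εU : ℕ → ℝ) (hεU : ∀ j, 0 ≤ εU j)
  (hUε : ∀ (j : ℕ) (b : Bond d (towerP L m (j + 1))), ‖(UlevOf L m (n + 1) U j b : 𝔸) - 1‖ ≤ εU j)

include hφ hφ' hMφ hMφ' hεU hUε in
/-- **THE TOWER LETTER `δ_{Q,k}` ON THE CHAIN's CARRIERS, VOLUME-FREE** (left-hand side VERBATIM that of `B9Eq315QTowerLipschitz.norm_QkW_sub_flat_le`):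
`‖Q_k(U)f − Q_k(1)f‖_{L²(c₁)} ≤ M_φ′·M_φ·√(c₁∕(c₀·(L^{n+1})^d))·(Π_{j≤n}(1 + √(L^d)·√(2d)·102(d+1)²L·ε_j) − 1)·‖f‖_{L²(c₀)}`, `k = n+1` — NO `|𝔅(T)|`; along (3.16)
`√(c₁∕(c₀L^{kd})) = (ηL^k)⁻¹`. [cite: Balaban1985BackgroundPropagators, (3.15)–(3.16) p.393, (3.35)–(3.37) p.396, (3.78)–(3.79) p.406, p.407; Balaban1985Averaging, (124)–(127) pp.36–37] -/
theorem norm_QkW_sub_flat_le_L2 (f : BondL2K ℂ d (towerP L m (n + 1)) c₀ W) :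
    ‖QkW L m n φ U hL α hα1 hU1 hreg (c₀ := c₀) (c₁ := c₁) f -
        QkW L m n φ (fun _ : Bond d (towerP L m (n + 1)) => (1 : 𝔸ˣ)) hL (fun _ => 0) (fun _ => by norm_num)
          (perCfg_UlevOf_one_mem_U1 L m (n + 1)) (norm_Wcx_UlevOf_one_sub_one_le L m (n + 1) (fun _ => 0) (fun _ => le_rfl)) (c₀ := c₀) (c₁ := c₁) f‖ ≤
      Mφ' * Mφ * Real.sqrt (c₁ / (c₀ * ((L : ℝ) ^ (n + 1)) ^ d)) *
        ((∏ j ∈ Finset.range (n + 1), (1 + Real.sqrt ((L : ℝ) ^ d) * (Real.sqrt (2 * d) * (102 * (d + 1) ^ 2 * L * εU j)))) - 1) * ‖f‖ := by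
  have hc₀ : 0 < c₀ := Fact.out
  have hc₁ : 0 < c₁ := Fact.out
  have hL0 : (0 : ℝ) < L := by exact_mod_cast hL
  set g : Bond d (towerP L m (n + 1)) → 𝔸 := fun b => φ (WL2.equiv ℂ (fun _ : Bond d (towerP L m (n + 1)) => c₀) W f b) with hg
  set P : ℝ := (∏ j ∈ Finset.range (n + 1), (1 + Real.sqrt ((L : ℝ) ^ d) * (Real.sqrt (2 * d) * (102 * (d + 1) ^ 2 * L * εU j)))) - 1 with hP
  have hP0 : 0 ≤ P := by
    rw [hP, sub_nonneg]
    exact Finset.one_le_prod (s := Finset.range (n + 1)) fun j _ => by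
      have := hεU j; nlinarith [Real.sqrt_nonneg ((L : ℝ) ^ d), Real.sqrt_nonneg (2 * (d : ℝ)), show (0:ℝ) ≤ Real.sqrt ((L : ℝ) ^ d) * (Real.sqrt (2 * d) * (102 * (d + 1) ^ 2 * L * εU j)) by positivity]
  -- the fine side: `√(Σ_b ‖g b‖²) ≤ M_φ·‖f‖∕√c₀`
  have hn : ‖f‖ ^ 2 = ∑ b, c₀ * ‖WL2.equiv ℂ (fun _ : Bond d (towerP L m (n + 1)) => c₀) W f b‖ ^ 2 :=
    WL2.norm_sq (𝕜 := ℂ) (w := fun _ : Bond d (towerP L m (n + 1)) => c₀) (V := W) f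
  have hfine : ∑ b, ‖g b‖ ^ 2 ≤ Mφ ^ 2 * (c₀⁻¹ * ‖f‖ ^ 2) := by
    rw [hn, Finset.mul_sum, Finset.mul_sum]
    refine Finset.sum_le_sum fun b _ => ?_
    have h1 : ‖g b‖ ^ 2 ≤ (Mφ * ‖WL2.equiv ℂ (fun _ : Bond d (towerP L m (n + 1)) => c₀) W f b‖) ^ 2 :=
      pow_le_pow_left₀ (norm_nonneg _) (hφ _) 2
    refine h1.trans (le_of_eq ?_)
    field_simp
  have hfine' : Real.sqrt (∑ b, ‖g b‖ ^ 2) ≤ Mφ * (‖f‖ / Real.sqrt c₀) := by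
    calc Real.sqrt (∑ b, ‖g b‖ ^ 2) ≤ Real.sqrt (Mφ ^ 2 * (c₀⁻¹ * ‖f‖ ^ 2)) := Real.sqrt_le_sqrt hfine
      _ = Mφ * (‖f‖ / Real.sqrt c₀) := by
          rw [Real.sqrt_mul' _ (by positivity), Real.sqrt_sq hMφ, Real.sqrt_mul' _ (by positivity), Real.sqrt_sq (norm_nonneg _),
            Real.sqrt_inv, div_eq_inv_mul]
  -- the `ℓ²` telescoping at the `𝔸`-valued function `g`
  have htel := sqrt_sum_norm_sq_Qtower_sub_flat_le L m hL (n + 1) U α hα1 hU1 hreg εU hεU hUε (n + 1) g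
  -- the coarse side: the weighted norm is `√c₁·√(Σ_c ‖value(c)‖²)`, each value `φ⁻¹` of the `𝔸`-valued difference
  have hval : ∀ c : Bond d m, ‖WL2.equiv ℂ (fun _ : Bond d m => c₁) W (QkW L m n φ U hL α hα1 hU1 hreg (c₀ := c₀) (c₁ := c₁) f -
        QkW L m n φ (fun _ : Bond d (towerP L m (n + 1)) => (1 : 𝔸ˣ)) hL (fun _ => 0) (fun _ => by norm_num)
          (perCfg_UlevOf_one_mem_U1 L m (n + 1)) (norm_Wcx_UlevOf_one_sub_one_le L m (n + 1) (fun _ => 0) (fun _ => le_rfl)) (c₀ := c₀) (c₁ := c₁) f) c‖ ^ 2 ≤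
      Mφ' ^ 2 * ‖QkOfU L m hL (n + 1) U α hα1 hU1 hreg g c -
        QkOfU L m hL (n + 1) (fun _ : Bond d (towerP L m (n + 1)) => (1 : 𝔸ˣ)) (fun _ => 0) (fun _ => by norm_num)
          (perCfg_UlevOf_one_mem_U1 L m (n + 1)) (norm_Wcx_UlevOf_one_sub_one_le L m (n + 1) (fun _ => 0) (fun _ => le_rfl)) g c‖ ^ 2 := by
    intro c
    rw [WL2.equiv_sub, Pi.sub_apply]
    show ‖φ.symm (QkOfU L m hL (n + 1) U α hα1 hU1 hreg g c) -
        φ.symm (QkOfU L m hL (n + 1) (fun _ : Bond d (towerP L m (n + 1)) => (1 : 𝔸ˣ)) (fun _ => 0) (fun _ => by norm_num)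
          (perCfg_UlevOf_one_mem_U1 L m (n + 1)) (norm_Wcx_UlevOf_one_sub_one_le L m (n + 1) (fun _ => 0) (fun _ => le_rfl)) g c)‖ ^ 2 ≤ _
    rw [← map_sub, ← mul_pow]
    exact pow_le_pow_left₀ (norm_nonneg _) (hφ' _) 2
  have hsq : ‖QkW L m n φ U hL α hα1 hU1 hreg (c₀ := c₀) (c₁ := c₁) f -
        QkW L m n φ (fun _ : Bond d (towerP L m (n + 1)) => (1 : 𝔸ˣ)) hL (fun _ => 0) (fun _ => by norm_num)
          (perCfg_UlevOf_one_mem_U1 L m (n + 1)) (norm_Wcx_UlevOf_one_sub_one_le L m (n + 1) (fun _ => 0) (fun _ => le_rfl)) (c₀ := c₀) (c₁ := c₁) f‖ ^ 2 ≤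
      c₁ * Mφ' ^ 2 * ∑ c, ‖QkOfU L m hL (n + 1) U α hα1 hU1 hreg g c -
        QkOfU L m hL (n + 1) (fun _ : Bond d (towerP L m (n + 1)) => (1 : 𝔸ˣ)) (fun _ => 0) (fun _ => by norm_num)
          (perCfg_UlevOf_one_mem_U1 L m (n + 1)) (norm_Wcx_UlevOf_one_sub_one_le L m (n + 1) (fun _ => 0) (fun _ => le_rfl)) g c‖ ^ 2 := by
    rw [WL2.norm_sq (𝕜 := ℂ) (w := fun _ : Bond d m => c₁) (V := W), Finset.mul_sum]
    exact Finset.sum_le_sum fun c _ => by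
      have := mul_le_mul_of_nonneg_left (hval c) hc₁.le
      linarith [this]
  -- assemble: take square roots
  have hroot : ‖QkW L m n φ U hL α hα1 hU1 hreg (c₀ := c₀) (c₁ := c₁) f -
        QkW L m n φ (fun _ : Bond d (towerP L m (n + 1)) => (1 : 𝔸ˣ)) hL (fun _ => 0) (fun _ => by norm_num)
          (perCfg_UlevOf_one_mem_U1 L m (n + 1)) (norm_Wcx_UlevOf_one_sub_one_le L m (n + 1) (fun _ => 0) (fun _ => le_rfl)) (c₀ := c₀) (c₁ := c₁) f‖ ≤
      Real.sqrt c₁ * Mφ' * Real.sqrt (∑ c, ‖QkOfU L m hL (n + 1) U α hα1 hU1 hreg g c -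
        QkOfU L m hL (n + 1) (fun _ : Bond d (towerP L m (n + 1)) => (1 : 𝔸ˣ)) (fun _ => 0) (fun _ => by norm_num)
          (perCfg_UlevOf_one_mem_U1 L m (n + 1)) (norm_Wcx_UlevOf_one_sub_one_le L m (n + 1) (fun _ => 0) (fun _ => le_rfl)) g c‖ ^ 2) := by
    have h := Real.sqrt_le_sqrt hsq
    rw [Real.sqrt_sq (norm_nonneg _), Real.sqrt_mul' _ (Finset.sum_nonneg fun _ _ => by positivity), Real.sqrt_mul' _ (by positivity),
      Real.sqrt_sq hMφ'] at h
    exact h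
  refine hroot.trans ?_
  have hQk : ∑ c, ‖QkOfU L m hL (n + 1) U α hα1 hU1 hreg g c -
        QkOfU L m hL (n + 1) (fun _ : Bond d (towerP L m (n + 1)) => (1 : 𝔸ˣ)) (fun _ => 0) (fun _ => by norm_num)
          (perCfg_UlevOf_one_mem_U1 L m (n + 1)) (norm_Wcx_UlevOf_one_sub_one_le L m (n + 1) (fun _ => 0) (fun _ => le_rfl)) g c‖ ^ 2 =
      ∑ c : Bond d m, ‖Qtower L m hL (UlevOf L m (n + 1) U) α hα1 hU1 hreg (n + 1) g c -
        Qtower L m hL (UlevOf L m (n + 1) (fun _ : Bond d (towerP L m (n + 1)) => (1 : 𝔸ˣ))) (fun _ => 0) (fun _ => by norm_num)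
          (perCfg_UlevOf_one_mem_U1 L m (n + 1)) (norm_Wcx_UlevOf_one_sub_one_le L m (n + 1) (fun _ => 0) (fun _ => le_rfl)) (n + 1) g c‖ ^ 2 := rfl
  rw [hQk]
  calc Real.sqrt c₁ * Mφ' * Real.sqrt (∑ c : Bond d m, ‖Qtower L m hL (UlevOf L m (n + 1) U) α hα1 hU1 hreg (n + 1) g c -
          Qtower L m hL (UlevOf L m (n + 1) (fun _ : Bond d (towerP L m (n + 1)) => (1 : 𝔸ˣ))) (fun _ => 0) (fun _ => by norm_num)
            (perCfg_UlevOf_one_mem_U1 L m (n + 1)) (norm_Wcx_UlevOf_one_sub_one_le L m (n + 1) (fun _ => 0) (fun _ => le_rfl)) (n + 1) g c‖ ^ 2)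
      ≤ Real.sqrt c₁ * Mφ' * (P * ((Real.sqrt (((L : ℝ) ^ d)⁻¹)) ^ (n + 1) * Real.sqrt (∑ b, ‖g b‖ ^ 2))) :=
        mul_le_mul_of_nonneg_left htel (by positivity)
    _ ≤ Real.sqrt c₁ * Mφ' * (P * ((Real.sqrt (((L : ℝ) ^ d)⁻¹)) ^ (n + 1) * (Mφ * (‖f‖ / Real.sqrt c₀)))) := by gcongr
    _ = Mφ' * Mφ * Real.sqrt (c₁ / (c₀ * ((L : ℝ) ^ (n + 1)) ^ d)) * P * ‖f‖ := by
        have hρ : (Real.sqrt (((L : ℝ) ^ d)⁻¹)) ^ (n + 1) = Real.sqrt ((((L : ℝ) ^ (n + 1)) ^ d)⁻¹) := by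
          rw [sqrt_pow_eq (by positivity : (0:ℝ) ≤ ((L : ℝ) ^ d)⁻¹) (n + 1)]
          congr 1
          rw [inv_pow, ← pow_mul, ← pow_mul, Nat.mul_comm d (n + 1)]
        have hsplit : Real.sqrt (c₁ / (c₀ * ((L : ℝ) ^ (n + 1)) ^ d)) = Real.sqrt c₁ * (Real.sqrt ((((L : ℝ) ^ (n + 1)) ^ d)⁻¹) * (Real.sqrt c₀)⁻¹) := by
          rw [div_eq_mul_inv, mul_inv, Real.sqrt_mul hc₁.le, Real.sqrt_mul (inv_nonneg.2 hc₀.le), Real.sqrt_inv c₀]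
          ring
        rw [hρ, hsplit, div_eq_mul_inv]
        ring

include hφ hφ' hMφ hMφ' hεU hUε in
/-- **… WITH THE PRODUCT BOUNDED BY AN EXPONENTIAL OF `Σ_j ε_j`**: `‖Q_k(U)f − Q_k(1)f‖ ≤ M_φ′M_φ·√(c₁∕(c₀L^{kd}))·(exp(√(L^d)·√(2d)·102(d+1)²L·Σ_{j<k} ε_j) − 1)·‖f‖`
— the number of levels enters ONLY through `Σ_{j<k} ε_j`. [cite: Balaban1985BackgroundPropagators, (3.15)–(3.16) p.393, (3.35)–(3.37) p.396, (3.78)–(3.79) p.406] -/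
theorem norm_QkW_sub_flat_le_L2_exp (f : BondL2K ℂ d (towerP L m (n + 1)) c₀ W) :
    ‖QkW L m n φ U hL α hα1 hU1 hreg (c₀ := c₀) (c₁ := c₁) f -
        QkW L m n φ (fun _ : Bond d (towerP L m (n + 1)) => (1 : 𝔸ˣ)) hL (fun _ => 0) (fun _ => by norm_num)
          (perCfg_UlevOf_one_mem_U1 L m (n + 1)) (norm_Wcx_UlevOf_one_sub_one_le L m (n + 1) (fun _ => 0) (fun _ => le_rfl)) (c₀ := c₀) (c₁ := c₁) f‖ ≤
      Mφ' * Mφ * Real.sqrt (c₁ / (c₀ * ((L : ℝ) ^ (n + 1)) ^ d)) *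
        (Real.exp (Real.sqrt ((L : ℝ) ^ d) * (Real.sqrt (2 * d) * (102 * (d + 1) ^ 2 * L)) * ∑ j ∈ Finset.range (n + 1), εU j) - 1) * ‖f‖ := by
  have base := norm_QkW_sub_flat_le_L2 L m n hL φ hMφ hMφ' hφ hφ' (c₀ := c₀) (c₁ := c₁) U α hα1 hU1 hreg εU hεU hUε f
  have ht : ∀ j, (0 : ℝ) ≤ Real.sqrt ((L : ℝ) ^ d) * (Real.sqrt (2 * d) * (102 * (d + 1) ^ 2 * L * εU j)) := fun j => by have := hεU j; positivity
  have hP : (∏ j ∈ Finset.range (n + 1), (1 + Real.sqrt ((L : ℝ) ^ d) * (Real.sqrt (2 * d) * (102 * (d + 1) ^ 2 * L * εU j)))) ≤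
      Real.exp (Real.sqrt ((L : ℝ) ^ d) * (Real.sqrt (2 * d) * (102 * (d + 1) ^ 2 * L)) * ∑ j ∈ Finset.range (n + 1), εU j) := by
    refine (prod_one_add_le_exp_sum _ ht (n + 1)).trans (le_of_eq ?_)
    rw [Finset.mul_sum]
    exact congrArg Real.exp (Finset.sum_congr rfl fun j _ => by ring)
  refine base.trans ?_
  have h0 : 0 ≤ Mφ' * Mφ * Real.sqrt (c₁ / (c₀ * ((L : ℝ) ^ (n + 1)) ^ d)) := by positivity
  have := mul_le_mul_of_nonneg_left (sub_le_sub_right hP 1) (mul_nonneg h0 (norm_nonneg f))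
  nlinarith [this]

include hφ hφ' hMφ hMφ' hεU hUε in
/-- **`δ_{Q,k}` IN `L²` UNDER THE ε-PROFILE IS FREE OF THE NUMBER OF LEVELS AND OF EVERY VOLUME**: if `ε_j ≤ ε⋆r^j` for the levels `j < k`
(`0 ≤ r < 1`, `0 ≤ ε⋆`), then `‖Q_k(U)f − Q_k(1)f‖ ≤ M_φ′M_φ·√(c₁∕(c₀L^{kd}))·(exp(√(L^d)·√(2d)·102(d+1)²L·ε⋆∕(1−r)) − 1)·‖f‖` — cf.
`B9Eq315QTowerLipschitzProfile.norm_QkW_sub_flat_le_geometric`, whose `√(c₁|𝔅(T_m)|∕c₀)` this replaces by `√(c₁∕(c₀L^{kd})) = (ηL^k)⁻¹`.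
[cite: Balaban1985BackgroundPropagators, (3.15)–(3.16) p.393, (3.35)–(3.37) p.396, (3.78)–(3.79) p.406; Balaban1985Averaging, Prop. 2 (52)–(54) p.26] -/
theorem norm_QkW_sub_flat_le_L2_geometric {r εs : ℝ} (hr0 : 0 ≤ r) (hr1 : r < 1) (hεs : 0 ≤ εs) (hεg : ∀ j < n + 1, εU j ≤ εs * r ^ j)
    (f : BondL2K ℂ d (towerP L m (n + 1)) c₀ W) :
    ‖QkW L m n φ U hL α hα1 hU1 hreg (c₀ := c₀) (c₁ := c₁) f -
        QkW L m n φ (fun _ : Bond d (towerP L m (n + 1)) => (1 : 𝔸ˣ)) hL (fun _ => 0) (fun _ => by norm_num)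
          (perCfg_UlevOf_one_mem_U1 L m (n + 1)) (norm_Wcx_UlevOf_one_sub_one_le L m (n + 1) (fun _ => 0) (fun _ => le_rfl)) (c₀ := c₀) (c₁ := c₁) f‖ ≤
      Mφ' * Mφ * Real.sqrt (c₁ / (c₀ * ((L : ℝ) ^ (n + 1)) ^ d)) *
        (Real.exp (Real.sqrt ((L : ℝ) ^ d) * (Real.sqrt (2 * d) * (102 * (d + 1) ^ 2 * L)) * (εs / (1 - r))) - 1) * ‖f‖ := by
  have base := norm_QkW_sub_flat_le_L2_exp L m n hL φ hMφ hMφ' hφ hφ' (c₀ := c₀) (c₁ := c₁) U α hα1 hU1 hreg εU hεU hUε f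
  have hS : ∑ j ∈ Finset.range (n + 1), εU j ≤ εs / (1 - r) :=
    (Finset.sum_le_sum fun j hj => hεg j (Finset.mem_range.1 hj)).trans (sum_geometric_le εs r hεs hr0 hr1 (n + 1))
  have hK : 0 ≤ Real.sqrt ((L : ℝ) ^ d) * (Real.sqrt (2 * d) * (102 * ((d : ℝ) + 1) ^ 2 * L)) := by positivity
  have hexp : Real.exp (Real.sqrt ((L : ℝ) ^ d) * (Real.sqrt (2 * d) * (102 * (d + 1) ^ 2 * L)) * ∑ j ∈ Finset.range (n + 1), εU j) ≤
      Real.exp (Real.sqrt ((L : ℝ) ^ d) * (Real.sqrt (2 * d) * (102 * (d + 1) ^ 2 * L)) * (εs / (1 - r))) :=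
    Real.exp_le_exp.2 (mul_le_mul_of_nonneg_left hS hK)
  refine base.trans ?_
  have h0 : 0 ≤ Mφ' * Mφ * Real.sqrt (c₁ / (c₀ * ((L : ℝ) ^ (n + 1)) ^ d)) := by positivity
  have := mul_le_mul_of_nonneg_left (sub_le_sub_right hexp 1) (mul_nonneg h0 (norm_nonneg f))
  nlinarith [this]

end Readings

end Literature.MathematicalPhysics.QuantumFieldTheory.Balaban1983to89.B9Eq315QTowerLipschitzL2

end
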